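import Summits.Ventures.PercRepro.RankLevelSetCoreEightLargeCorankArith
import Summits.Ventures.PercRepro.RankLevelSetLevelEightCube

/-!
# PercRepro — THE LARGE-CORANK REGIME AT LEVEL `8` WITH EXACT ARITHMETIC, PART 2: corank `≥ 172` closes for every `p ≥ 144`
(p2, gen 34; a feeder for S4 — the top of the `q = 8` window)

`c025_core_eight_large_corank`: the `e`-free core at level `8`, rank `p ≥ 144`, corank `≥ 172` satisfies `Φ·#U ≤ #Y` —
`#U ≤ #{r = 8} ≤ C(n, 8)·2^151` (the flat bound `159`, `ncard_eRk_eq_le_choose_mul_of_bound`),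
`#Y ≥ Σ_{8 ≤ k ≤ p−1} C(n, k) − #{r ≤ 8}` (`two_pow_le_midCount_add`, `ncard_spanning_le` and the split
`Σ_{k ∈ Ico 8 p} C(n, k) + Σ_{j ≤ d} C(n, j) ≤ 2^n`), `#{r ≤ 8} ≤ R₈(n)` (the flat bounds `159 / 79 / 39 / 19 / 10 / 6 / 3 / 1`),
`Φ ≤ 2^{p+8}/C(p+8, 8)`, and the inequality `largeEight_all` of Part 1 (RankLevelSetCoreEightLargeCorankArith).
The record's large-corank floor at level `8` was `186` (`c025_core_eight_beyond_sharp`). Axioms: standard.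
-/

set_option exponentiation.threshold 1024

namespace PercRepro

namespace ThmN

open Set

variable {α : Type}

/-- `Σ_{k ∈ Ico 8 p} C(n, k) + Σ_{j ≤ d} C(n, j) ≤ 2^n` for `n = p + d` (the first sum lies in `Σ_{k < p}`, the second is
`Σ_{k ≥ p}` by symmetry). -/
theorem sum_Ico_choose_add_sum_range_choose_le_eight (p d : ℕ) :
    ∑ k ∈ Finset.Ico 8 p, (p + d).choose k + ∑ j ∈ Finset.range (d + 1), (p + d).choose j ≤ 2 ^ (p + d) := by
  have h1 : ∑ k ∈ Finset.Ico 8 p, (p + d).choose k ≤ ∑ k ∈ Finset.range p, (p + d).choose k := by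
    rw [Finset.range_eq_Ico]
    exact Finset.sum_le_sum_of_subset (Finset.Ico_subset_Ico_left (by omega))
  have h2 : ∑ j ∈ Finset.range (d + 1), (p + d).choose j = ∑ k ∈ Finset.Ico p (p + d + 1), (p + d).choose k := by
    rw [Finset.sum_Ico_eq_sum_range, show p + d + 1 - p = d + 1 by omega]
    rw [← Finset.sum_range_reflect]
    apply Finset.sum_congr rfl
    intro j hj
    rw [Finset.mem_range] at hj
    rw [show d + 1 - 1 - j = d - j by omega, ← Nat.choose_symm (show d - j ≤ p + d by omega),
      show p + d - (d - j) = p + j by omega]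
  have h3 : ∑ k ∈ Finset.range p, (p + d).choose k + ∑ k ∈ Finset.Ico p (p + d + 1), (p + d).choose k =
      2 ^ (p + d) := by
    rw [Finset.range_eq_Ico, Finset.sum_Ico_consecutive _ (by omega) (by omega), ← Finset.range_eq_Ico,
      Nat.sum_range_choose]
  omega

/-- **THE `e`-FREE CORE AT LEVEL `8`, RANK `p ≥ 144`, CORANK `≥ 172`**: `Φ·#U ≤ #Y` — `#U ≤ C(n, 8)·2^151` (the flat bound
`159`), `#Y ≥ Σ_{8 ≤ k ≤ p−1} C(n, k) − #{r ≤ 8}`, `#{r ≤ 8} ≤ R₈(n)`, `Φ ≤ 2^{p+8}/C(p+8, 8)` and `largeEight_all`. -/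
theorem c025_core_eight_large_corank (M : Matroid α) [M.Finite] (p : ℕ) (hp : 144 ≤ p) (hR : M.eRank = (p : ℕ∞))
    (hbig : p + 171 < M.E.ncard)
    (hfree : ∀ e ∈ M.E, ∃ A ⊆ M.E \ {e}, e ∉ M.closure A ∧ e ∉ M.closure ((M.E \ {e}) \ A)) :
    RLS M p 8 := by
  classical
  set n := M.E.ncard with hn_def
  set d := n - p with hd_def
  have hnd : n = p + d := by
    have := M.eRank_le_encard_ground
    rw [hR, ← M.ground_finite.cast_ncard_eq] at this
    have hpn : p ≤ n := by exact_mod_cast this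
    omega
  have hd172 : 172 ≤ d := by omega
  have hEcard : M.ground_finite.toFinset.card = n := by
    rw [hn_def, Set.ncard_eq_toFinset_card _ M.ground_finite]
  have hencard : M.E.encard = M.eRank + d := by
    rw [hR, ← M.ground_finite.cast_ncard_eq, ← hn_def, hnd]
    push_cast
    ring
  have hL0 : ∀ e ∈ M.E, ¬ M.IsLoop e := not_isLoop_of_free M hfree
  -- (U): the rank-`8` sets through the flat bound `159`
  have hflat : ∀ X ⊆ M.E, M.eRk X ≤ 8 → X.ncard ≤ 159 :=
    fun X hX hr => ncard_le_one_fifty_nine_of_eRk_le_eight_of_free M hfree X hX hr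
  have hU : Matroid.topCount M p 8 ≤ n.choose 8 * 2 ^ 151 := by
    calc Matroid.topCount M p 8 ≤ Matroid.levelCount M 8 := Matroid.topCount_le_levelCount_bot p 8
      _ = {X : Set α | X ⊆ M.E ∧ M.eRk X = (8 : ℕ)}.ncard := rfl
      _ ≤ n.choose 8 * 2 ^ (159 - 8) := by
          rw [← hEcard]; exact ncard_eRk_eq_le_choose_mul_of_bound M 8 159 hflat
  -- (A): the rank-`≤ 8` sets through the flat bounds
  have hsum8 := S2.ncard_eRk_le_le_sum M 8
  simp only [Finset.sum_range_succ, Finset.sum_range_zero, zero_add] at hsum8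
  have h8 : {X : Set α | X ⊆ M.E ∧ M.eRk X = (8 : ℕ)}.ncard ≤ M.E.ncard.choose 8 * 2 ^ (159 - 8) :=
    S2.ncard_eRk_eq_le_choose_mul_two_pow M 8 159 (fun X hX hr => hflat X hX (by exact_mod_cast hr))
  have h7 : {X : Set α | X ⊆ M.E ∧ M.eRk X = (7 : ℕ)}.ncard ≤ M.E.ncard.choose 7 * 2 ^ (79 - 7) :=
    S2.ncard_eRk_eq_le_choose_mul_two_pow M 7 79
      (fun X hX hr => ncard_le_seventynine_of_eRk_le_seven_of_free M hfree X hX (by exact_mod_cast hr))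
  have h6 : {X : Set α | X ⊆ M.E ∧ M.eRk X = (6 : ℕ)}.ncard ≤ M.E.ncard.choose 6 * 2 ^ (39 - 6) :=
    S2.ncard_eRk_eq_le_choose_mul_two_pow M 6 39
      (fun X hX hr => ncard_le_thirtynine_of_eRk_le_six_of_free M hfree hX (by exact_mod_cast hr))
  have h5 : {X : Set α | X ⊆ M.E ∧ M.eRk X = (5 : ℕ)}.ncard ≤ M.E.ncard.choose 5 * 2 ^ (19 - 5) :=
    S2.ncard_eRk_eq_le_choose_mul_two_pow M 5 19
      (fun X hX hr => ncard_le_nineteen_of_eRk_le_five_of_free M hfree hX (by exact_mod_cast hr))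
  have h4 : {X : Set α | X ⊆ M.E ∧ M.eRk X = (4 : ℕ)}.ncard ≤ M.E.ncard.choose 4 * 2 ^ (10 - 4) :=
    S2.ncard_eRk_eq_le_choose_mul_two_pow M 4 10
      (fun X hX hr => ncard_le_ten_of_eRk_le_four_of_free M hfree hX (by exact_mod_cast hr))
  have h3 : {X : Set α | X ⊆ M.E ∧ M.eRk X = (3 : ℕ)}.ncard ≤ M.E.ncard.choose 3 * 2 ^ (6 - 3) :=
    S2.ncard_eRk_eq_le_choose_mul_two_pow M 3 6
      (fun X hX hr => ncard_le_six_of_eRk_le_three_of_free M hfree hX (by exact_mod_cast hr))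
  have h2 : {X : Set α | X ⊆ M.E ∧ M.eRk X = (2 : ℕ)}.ncard ≤ M.E.ncard.choose 2 * 2 ^ (3 - 2) :=
    S2.ncard_eRk_eq_le_choose_mul_two_pow M 2 3
      (fun X hX hr => by
        have := ncard_add_one_le_two_pow_of_eRk_le M hL0 hfree 2 X hX hr
        omega)
  have h1 : {X : Set α | X ⊆ M.E ∧ M.eRk X = (1 : ℕ)}.ncard ≤ M.E.ncard.choose 1 * 2 ^ (1 - 1) :=
    S2.ncard_eRk_eq_le_choose_mul_two_pow M 1 1
      (fun X hX hr => by
        have := ncard_add_one_le_two_pow_of_eRk_le M hL0 hfree 1 X hX hr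
        omega)
  have h0 : {X : Set α | X ⊆ M.E ∧ M.eRk X = (0 : ℕ)}.ncard ≤ M.E.ncard.choose 0 * 2 ^ (0 - 0) :=
    S2.ncard_eRk_eq_le_choose_mul_two_pow M 0 0
      (fun X hX hr => by
        have := ncard_add_one_le_two_pow_of_eRk_le M hL0 hfree 0 X hX hr
        omega)
  simp only [Nat.choose_one_right, Nat.choose_zero_right, Nat.sub_self, pow_zero, mul_one] at h1 h0
  rw [← hn_def] at h8 h7 h6 h5 h4 h3 h2 h1
  push_cast at hsum8 h8 h7 h6 h5 h4 h3 h2 h1 h0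
  have hA : {X : Set α | X ⊆ M.E ∧ M.eRk X ≤ 8}.ncard ≤
      n.choose 8 * 2 ^ 151 + n.choose 7 * 2 ^ 72 + n.choose 6 * 2 ^ 33 + n.choose 5 * 2 ^ 14 + n.choose 4 * 2 ^ 6 +
        n.choose 3 * 2 ^ 3 + n.choose 2 * 2 + n + 1 := by
    omega
  -- (Y): `2^n ≤ Y + A + B`, `B ≤ Σ_{j ≤ d} C(n, j)`, and `Σ_{k ∈ Ico 8 p} C(n, k) + Σ_{j ≤ d} C(n, j) ≤ 2^n`
  have hY := Matroid.two_pow_le_midCount_add (M := M) p 8 hR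
  have hB := Matroid.ncard_spanning_le (M := M) hencard
  rw [hEcard] at hY hB
  push_cast at hY
  have hsplit := sum_Ico_choose_add_sum_range_choose_le_eight p d
  rw [← hnd] at hsplit
  have hYge : ∑ k ∈ Finset.Ico 8 p, n.choose k ≤
      Matroid.midCount M p 8 + {X : Set α | X ⊆ M.E ∧ M.eRk X ≤ 8}.ncard := by
    omega
  -- assemble in `ℚ`
  have hΦ := phiK_le_two_pow_div p 8
  rw [Nat.choose_symm_add] at hΦ
  have hineq := largeEight_all p hp n (by omega)
  rw [RLS_iff]
  have hc : (0 : ℚ) < ((p + 8).choose 8 : ℚ) := by exact_mod_cast Nat.choose_pos (by omega)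
  have hU0 : (0 : ℚ) ≤ (Matroid.topCount M p 8 : ℚ) := Nat.cast_nonneg _
  have hUq : (Matroid.topCount M p 8 : ℚ) ≤ (n.choose 8 : ℚ) * 2 ^ 151 := by exact_mod_cast hU
  have hAq : ({X : Set α | X ⊆ M.E ∧ M.eRk X ≤ 8}.ncard : ℚ) ≤
      ((n.choose 8 * 2 ^ 151 + n.choose 7 * 2 ^ 72 + n.choose 6 * 2 ^ 33 + n.choose 5 * 2 ^ 14 + n.choose 4 * 2 ^ 6 +
        n.choose 3 * 2 ^ 3 + n.choose 2 * 2 + n + 1 : ℕ) : ℚ) := by exact_mod_cast hA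
  have hYq : ((∑ k ∈ Finset.Ico 8 p, n.choose k : ℕ) : ℚ) ≤
      (Matroid.midCount M p 8 : ℚ) + ({X : Set α | X ⊆ M.E ∧ M.eRk X ≤ 8}.ncard : ℚ) := by exact_mod_cast hYge
  have hΦU : phiK p 8 * (Matroid.topCount M p 8 : ℚ) ≤
      (2 : ℚ) ^ (p + 159) * (n.choose 8 : ℚ) / ((p + 8).choose 8 : ℚ) := by
    calc phiK p 8 * (Matroid.topCount M p 8 : ℚ)
        ≤ (2 : ℚ) ^ (p + 8) / ((p + 8).choose 8 : ℚ) * ((n.choose 8 : ℚ) * 2 ^ 151) :=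
          mul_le_mul hΦ hUq hU0 (by positivity)
      _ = (2 : ℚ) ^ (p + 159) * (n.choose 8 : ℚ) / ((p + 8).choose 8 : ℚ) := by
          rw [show p + 159 = p + 8 + 151 by ring, pow_add]; ring
  calc phiK p 8 * (Matroid.topCount M p 8 : ℚ)
      ≤ (2 : ℚ) ^ (p + 159) * (n.choose 8 : ℚ) / ((p + 8).choose 8 : ℚ) := hΦU
    _ ≤ ((∑ k ∈ Finset.Ico 8 p, n.choose k : ℕ) : ℚ) -
        ((n.choose 8 * 2 ^ 151 + n.choose 7 * 2 ^ 72 + n.choose 6 * 2 ^ 33 + n.choose 5 * 2 ^ 14 + n.choose 4 * 2 ^ 6 +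
          n.choose 3 * 2 ^ 3 + n.choose 2 * 2 + n + 1 : ℕ) : ℚ) := by linarith [hineq]
    _ ≤ ((∑ k ∈ Finset.Ico 8 p, n.choose k : ℕ) : ℚ) -
        ({X : Set α | X ⊆ M.E ∧ M.eRk X ≤ 8}.ncard : ℚ) := by linarith [hAq]
    _ ≤ (Matroid.midCount M p 8 : ℚ) := by linarith [hYq]

end ThmN

end PercRepro
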